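import Literature.Probability.Percolation.InterfaceLoopPolygon
import Literature.Probability.Percolation.HexLatticeSegments
import Literature.Probability.Percolation.TriBoundaryLoopWinding
import Literature.Topology.PlaneTopology.AnnulusArcs
import HarnessLib

/-!
# Winding numbers of site-percolation interface loops: the jump across a crossed edge

Topic: Probability / Percolation. The planar-topological bookkeeping, by winding numbers and
without the Jordan curve theorem, for the interface loops of a site configuration on `𝕋`
(`IsSiteInterfaceLoop`, `CLE6.lean`), in the form used to produce **macroscopic** interface loops
(a loop through the edge between a large open cluster and a large closed cluster is large) in
the Camia–Newman theory of the full scaling limit (F. Camia, C. M. Newman, Comm. Math. Phys. 268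
(2006), §2 and Thm 2 (ii): "every deterministic point is surrounded by infinitely many loops";
the planar input there is the Jordan curve theorem for lattice polygons, replaced here by the
argument principle as in `TriLoopWinding.lean` / `InterfaceWindingJump.lean`):

* `loopPath δ w` — the closed interface polygon at mesh `δ` as a Mathlib `Path` (the stretch
  `polySubPath δ w 0 (n - 1)` over all darts), `range_loopPath` (its range is the trace
  `polyTrace δ w`), `range_toCurve_eq_polyTrace` (so is the range of the curve `w.toCurve`);
* `loopWind δ w p` — the winding number of that polygon about `p`;
* `IsSiteInterfaceLoop.loopWind_leftPt_sub_loopWind_rightPt` — **the jump**: for every step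
  `i`, `wind (left site) - wind (right site) = 1`: the `i`-th dart piece crosses the side segment
  `[leftPt, rightPt]` once, transversally, from its positive to its negative side
  (`segSide_polyPt_pos`, `segSide_polyPt_succ_neg`, `IsSiteInterfaceLoop.exists_cross`), all other
  pieces miss it (`polyPiece_disjoint_sideSeg`), and the crossing defect of `ArgumentIncrement.lean`
  converts the single signed crossing into the difference of winding numbers
  (`Path.crossInc_loop` via `crossInc_eq_wind_sub_of_eq`, `crossInc_polySubPath_eq`,
  `Path.crossInc_segment_of_cross`);
* `loopWind_eq_of_mem_connectedComponentIn` — the winding number is constant on connected sets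
  missing the trace (`wind_sub_eq_of_mem_connectedComponentIn`); `loopWind_triMeshPoint_eq_of_adj` —
  in particular equal at two equal-or-adjacent sites whose edge is not crossed by the loop (e.g.
  two open sites, or two closed sites);
* `loopWind_eq_zero_of_lt_dist` — it vanishes at points farther from a centre than the trace
  (`wind_sub_eq_zero_of_dist_le`).

Everything is proved; no named facts are introduced.

## References

* F. Camia, C. M. Newman, Comm. Math. Phys. 268 (2006), §2, Thm 2 [CamiaNewman2006].
* L. V. Ahlfors, *Complex Analysis*, 3rd ed. (1979), §4.2.1 (winding numbers).
* B. Bollobás, O. Riordan, *Percolation* (2006), Ch. 7 §7.2.3 (winding arguments for interfaces).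
-/

noncomputable section

open Set Metric Complex
open Literature.Topology.PlaneTopology

namespace Literature.Probability.Percolation

open LatticeModels

/-! ### The closed interface polygon as a path; its range -/

section Polygon

variable {f₀ g₀ : HexVertex} (δ : ℝ) (w : hexGraph.Walk f₀ g₀)

/-- Every dart piece of a stretch lies in the range of the stretch. [folklore] -/
theorem polyPiece_subset_range_polySubPath (i₀ : ℕ) :
    ∀ k j : ℕ, j ≤ k → polyPiece δ w (i₀ + j) ⊆ range (polySubPath δ w i₀ k)
  | 0, j, hj => by
    obtain rfl : j = 0 := by omega
    rw [polySubPath, Path.range_segment]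
    rfl
  | k + 1, j, hj => by
    rw [polySubPath, Path.trans_range, Path.range_segment]
    rcases Nat.lt_or_ge j (k + 1) with h | h
    · exact (polyPiece_subset_range_polySubPath i₀ k j (by omega)).trans subset_union_left
    · obtain rfl : j = k + 1 := by omega
      rw [show i₀ + (k + 1) = i₀ + k + 1 by omega]
      exact subset_union_right

/-- **The range of a stretch is the union of its dart pieces.** [folklore] -/
theorem range_polySubPath_eq (i₀ k : ℕ) :
    range (polySubPath δ w i₀ k) = ⋃ (j : ℕ) (_ : j ≤ k), polyPiece δ w (i₀ + j) :=
  (range_polySubPath_subset i₀ k).antisymm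
    (iUnion₂_subset fun j hj ↦ polyPiece_subset_range_polySubPath δ w i₀ k j hj)

variable {δ w} in
/-- The range of the stretch over all darts is the trace. [folklore] -/
theorem range_polySubPath_zero (hlen : 0 < w.length) :
    range (polySubPath δ w 0 (w.length - 1)) = polyTrace δ w := by
  rw [range_polySubPath_eq]
  ext z
  simp only [mem_iUnion, zero_add, mem_polyTrace_iff, exists_prop]
  constructor
  · rintro ⟨j, hj, hz⟩; exact ⟨j, by omega, hz⟩
  · rintro ⟨j, hj, hz⟩; exact ⟨j, by omega, hz⟩

/-- Every segment of a polyline through `p 0, …, p n` lies in its range. [folklore] -/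
theorem segment_subset_range_polylineFrom_ptsList {E : Type*} [AddCommGroup E] [Module ℝ E]
    [TopologicalSpace E] [ContinuousAdd E] [ContinuousSMul ℝ E] :
    ∀ (p : ℕ → E) (n k : ℕ), k < n →
      segment ℝ (p k) (p (k + 1)) ⊆ range (polylineFrom (p 0) (ptsList p n)).2
  | p, 0, k, hk => by omega
  | p, n + 1, k, hk => by
    change segment ℝ (p k) (p (k + 1)) ⊆
      range ((Path.segment (p 0) (p 1)).trans (polylineFrom (p 1) (ptsList (fun k => p (k + 1)) n)).2)
    rw [Path.trans_range, Path.range_segment]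
    rcases k with _ | k
    · exact subset_union_left
    · exact (segment_subset_range_polylineFrom_ptsList (fun k => p (k + 1)) n k (by omega)).trans
        subset_union_right

variable {δ w} in
/-- **The range of the curve of a walk of `H` is its trace** (for a walk with at least one
dart): the polyline visits exactly the dart pieces (Smirnov 2001, §2; Camia–Newman 2006, §4:
the interface as a polygonal curve). [folklore] -/
theorem range_toCurve_eq_polyTrace (hlen : 0 < w.length) :
    range (w.toCurve fun F ↦ (δ : ℂ) * hexCenter F) = polyTrace δ w := by
  refine (range_toCurve_subset_polyTrace hlen).antisymm fun z hz ↦ ?_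
  obtain ⟨i, hi, hz⟩ := mem_polyTrace_iff.1 hz
  have h := segment_subset_range_polylineFrom_ptsList (polyPt δ w) w.length i hi hz
  obtain ⟨u, hu⟩ := h
  exact ⟨u, by rw [toCurve_eq_polylineFrom_ptsList]; exact hu⟩

end Polygon

/-! ### The winding number of a closed interface polygon -/

section Wind

variable {f₀ : HexVertex}

/-- **The closed interface polygon at mesh `δ` as a path**: the stretch of `polySubPath` over
all `n` darts of the closed walk `w`, from the centre of the base face back to it (a path from
`polyPt δ w 0` to `polyPt δ w (0 + (n - 1) + 1)`, the same point). [folklore] -/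
def loopPath (δ : ℝ) (w : hexGraph.Walk f₀ f₀) : Path (polyPt δ w 0) (polyPt δ w (0 + (w.length - 1) + 1)) :=
  polySubPath δ w 0 (w.length - 1)

/-- **The winding number of the closed interface polygon** of `w` at mesh `δ` about the point
`p` (the plane-topology prelude's `wind` of `t ↦ Γ(t) - p`; meaningful for `p` off the trace).
(Ahlfors, *Complex Analysis*, §4.2.1.) [folklore] -/
def loopWind (δ : ℝ) (w : hexGraph.Walk f₀ f₀) (p : ℂ) : ℤ :=
  wind fun t ↦ (loopPath δ w).extend t - p

variable {δ : ℝ} {w : hexGraph.Walk f₀ f₀}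

/-- The closed polygon returns to its starting point. [folklore] -/
theorem polyPt_length_pred_succ (hlen : 0 < w.length) :
    polyPt δ w (0 + (w.length - 1) + 1) = polyPt δ w 0 := by
  rw [show 0 + (w.length - 1) + 1 = w.length by omega, polyPt, polyPt, SimpleGraph.Walk.getVert_length,
    SimpleGraph.Walk.getVert_zero]

/-- The range of the closed polygon is the trace. [folklore] -/
theorem range_loopPath (hlen : 0 < w.length) : range (loopPath δ w) = polyTrace δ w :=
  range_polySubPath_zero hlen

/-- The extension of the closed polygon takes values in the trace on `[0, 1]`. [folklore] -/
theorem mapsTo_extend_loopPath (hlen : 0 < w.length) :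
    MapsTo (loopPath δ w).extend (Icc 0 1) (polyTrace δ w) := by
  intro t ht
  rw [← range_loopPath hlen, Path.extend_apply _ ht]
  exact mem_range_self _

/-- The extension of the closed polygon is a loop: equal values at `0` and `1`. [folklore] -/
theorem extend_loopPath_zero_eq_one (hlen : 0 < w.length) :
    (loopPath δ w).extend 0 = (loopPath δ w).extend 1 := by
  rw [Path.extend_zero, Path.extend_one, polyPt_length_pred_succ hlen]

/-- The trace is closed (a finite union of closed segments). [folklore] -/
theorem isClosed_polyTrace (δ : ℝ) (w : hexGraph.Walk f₀ f₀) : IsClosed (polyTrace δ w) := by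
  rw [polyTrace]
  refine Set.Finite.isClosed_biUnion (Set.finite_lt_nat w.length) fun i _ ↦ ?_
  rw [polyPiece, ← Path.range_segment]
  exact isCompact_range (Path.segment _ _).continuous |>.isClosed

/-- The winding number is constant on connected sets missing the trace: if `q` lies in the
component of `p` in the complement of the trace, the closed polygon winds equally about `p` and
`q` (Eilenberg; `wind_sub_eq_of_mem_connectedComponentIn`). [folklore] -/
theorem loopWind_eq_of_mem_connectedComponentIn (hlen : 0 < w.length) {p q : ℂ}
    (hq : q ∈ connectedComponentIn (polyTrace δ w)ᶜ p) : loopWind δ w p = loopWind δ w q :=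
  wind_sub_eq_of_mem_connectedComponentIn (loopPath δ w).continuous_extend.continuousOn
    (extend_loopPath_zero_eq_one hlen) (isClosed_polyTrace δ w) (mapsTo_extend_loopPath hlen) hq

/-- **The winding number vanishes far away**: if the trace lies in `B̄(x, r)` and
`dist z x > r`, the closed polygon does not wind about `z` (`wind_sub_eq_zero_of_dist_le`).
[folklore] -/
theorem loopWind_eq_zero_of_lt_dist (hlen : 0 < w.length) {x z : ℂ} {r : ℝ}
    (hsub : polyTrace δ w ⊆ closedBall x r) (hz : r < dist z x) : loopWind δ w z = 0 :=
  wind_sub_eq_zero_of_dist_le (loopPath δ w).continuous_extend.continuousOn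
    (extend_loopPath_zero_eq_one hlen) (fun _ ht ↦ hsub (mapsTo_extend_loopPath hlen ht)) hz

end Wind

/-! ### The jump of the winding number across a crossed edge -/

section Jump

variable {ω : SiteConfig (Site 2)} {f₀ : HexVertex} {w : hexGraph.Walk f₀ f₀}
  (hw : IsSiteInterfaceLoop ω w) {δ : ℝ} (hδ : 0 < δ)

include hw hδ

omit hδ in
/-- **The `i`-th dart piece and the `i`-th side segment cross at their common midpoint**
(the hexagonal edge and the crossed edge of `𝕋` bisect each other). [folklore] -/
theorem IsSiteInterfaceLoop.exists_cross {i : ℕ} (hi : i < w.length) :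
    ∃ p ∈ polyPiece δ w i, p ∈ openSegment ℝ (hw.leftPt δ i) (hw.rightPt δ i) := by
  refine ⟨(δ : ℂ) * midpoint ℝ (hexCenter (w.getVert i)) (hexCenter (oppFace (w.getVert i) (hw.sideIdx i))),
    ?_, ?_⟩
  · rw [polyPiece, polyPt, polyPt, hw.getVert_succ_eq hi, ← Complex.real_smul, ← Complex.real_smul,
      ← Complex.real_smul, ← smul_segment_eq]
    exact smul_mem_smul_set (midpoint_mem_segment _ _)
  · rw [IsSiteInterfaceLoop.leftPt, IsSiteInterfaceLoop.rightPt, triMeshPoint, triMeshPoint, hw.lv_eq hi, hw.rv_eq hi,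
      ← Complex.real_smul, ← Complex.real_smul, ← Complex.real_smul, openSegment_eq_image]
    obtain ⟨θ, hθ, hθeq⟩ := (openSegment_eq_image (𝕜 := ℝ) (triEmbed (faceVertex (w.getVert i) (hw.sideIdx i + 2)))
      (triEmbed (faceVertex (w.getVert i) (hw.sideIdx i + 1)))).symm ▸
        midpoint_hexCenter_mem_openSegment (w.getVert i) (hw.sideIdx i)
    refine ⟨θ, hθ, ?_⟩
    simp only at hθeq ⊢
    rw [← hθeq, smul_add, smul_comm δ θ, smul_comm δ (1 - θ)]

/-- **The `i`-th dart piece has crossing defect `2πi` relative to its side segment** (it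
crosses `[leftPt, rightPt]` once, from the positive to the negative side). [folklore] -/
theorem IsSiteInterfaceLoop.crossInc_polyPiece {i : ℕ} (hi : i < w.length) :
    (Path.segment (polyPt δ w i) (polyPt δ w (i + 1))).crossInc (hw.leftPt δ i) (hw.rightPt δ i) =
      2 * Real.pi * I :=
  Path.crossInc_segment_of_cross (hw.segSide_polyPt_pos hδ hi) (hw.segSide_polyPt_succ_neg hδ hi)
    (hw.exists_cross hi)

/-- **The crossing defect of the whole closed polygon relative to the `i`-th side segment is that
of the `i`-th piece**: all other pieces miss the side segment (`polyPiece_disjoint_sideSeg`), and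
lattice points are off the pieces. [folklore] -/
theorem IsSiteInterfaceLoop.crossInc_loopPath {i : ℕ} (hi : i < w.length) :
    (loopPath δ w).crossInc (hw.leftPt δ i) (hw.rightPt δ i) = 2 * Real.pi * I := by
  obtain ⟨i, rfl⟩ : ∃ j, i = 0 + j := ⟨i, (zero_add i).symm⟩
  rw [← hw.crossInc_polyPiece hδ hi]
  exact crossInc_polySubPath_eq (δ := δ) (w := w) (ℓ := hw.leftPt δ (0 + i)) (r := hw.rightPt δ (0 + i)) 0 i
    (w.length - 1) (by omega)
    (fun j hj hji z hz hzs ↦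
      Set.disjoint_left.1 (hw.polyPiece_disjoint_sideSeg hδ (by omega) hi (by omega)) hz hzs)
    (hw.triMeshPoint_not_mem_polyPiece hδ _ hi) (hw.triMeshPoint_not_mem_polyPiece hδ _ hi)

/-- **The jump of the winding number across a crossed edge.** For every step `i` of an
interface loop `w` of `ω` at mesh `δ > 0`, the closed interface polygon winds once more about
the open site on the left of the `i`-th dart than about the closed site on its right:
`wind (leftPt i) - wind (rightPt i) = 1`. (The crossing defect of the polygon relative to the
side segment is `2πi`, `crossInc_loopPath`, and equals `2πi (wind ℓ - wind r)`,
`Path.crossInc_loop`.) This is the Jordan-curve-free form of "the open hexagon on the left and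
the closed hexagon on the right lie on different sides of the interface" (Camia–Newman 2006,
§2 and §4; Bollobás–Riordan 2006, Ch. 7 §7.2.3). [cite: CamiaNewman2006, §4] -/
theorem IsSiteInterfaceLoop.loopWind_leftPt_sub_loopWind_rightPt {i : ℕ} (hi : i < w.length) :
    loopWind δ w (hw.leftPt δ i) - loopWind δ w (hw.rightPt δ i) = 1 := by
  have hlen : 0 < w.length := by omega
  have hℓ : hw.leftPt δ i ∉ range (loopPath δ w) := by
    rw [range_loopPath hlen]; exact hw.leftPt_not_mem_polyTrace hδ i
  have hr : hw.rightPt δ i ∉ range (loopPath δ w) := by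
    rw [range_loopPath hlen]; exact hw.triMeshPoint_not_mem_polyTrace hδ _
  have ha := crossInc_eq_wind_sub_of_eq (loopPath δ w) (polyPt_length_pred_succ hlen) hℓ hr
  rw [hw.crossInc_loopPath hδ hi] at ha
  have h2 : (2 * Real.pi * I : ℂ) ≠ 0 := by simp [Real.pi_ne_zero, I_ne_zero]
  have h1 : ((loopWind δ w (hw.leftPt δ i) - loopWind δ w (hw.rightPt δ i) : ℤ) : ℂ) = 1 := by
    refine mul_right_cancel₀ h2 ?_
    rw [one_mul]
    push_cast
    exact ha.symm
  exact_mod_cast h1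

/-- **At least one side of a crossed edge is enclosed**: the winding number about the left site
or about the right site of every dart of an interface loop is non-zero. [folklore] -/
theorem IsSiteInterfaceLoop.loopWind_leftPt_ne_zero_or {i : ℕ} (hi : i < w.length) :
    loopWind δ w (hw.leftPt δ i) ≠ 0 ∨ loopWind δ w (hw.rightPt δ i) ≠ 0 := by
  by_contra h
  push Not at h
  have := hw.loopWind_leftPt_sub_loopWind_rightPt hδ hi
  rw [h.1, h.2] at this
  exact absurd this (by norm_num)

/-- **The winding number is the same at two equal or adjacent sites whose edge is not crossed by
the loop** (the mesh segment between them misses the trace, `eq_lv_rv_of_inter`): e.g. at two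
open sites or at two closed sites. [folklore] -/
theorem IsSiteInterfaceLoop.loopWind_triMeshPoint_eq_of_adj {a b : Site 2} (hab : a = b ∨ triGraph.Adj a b)
    (h : ∀ i < w.length, ¬ (a = hw.lv i ∧ b = hw.rv i) ∧ ¬ (a = hw.rv i ∧ b = hw.lv i)) :
    loopWind δ w (triMeshPoint δ a) = loopWind δ w (triMeshPoint δ b) := by
  have hlen : 0 < w.length := by have := hw.isCycle.three_le_length; omega
  refine loopWind_eq_of_mem_connectedComponentIn hlen ?_
  have hseg : segment ℝ (triMeshPoint δ a) (triMeshPoint δ b) ⊆ (polyTrace δ w)ᶜ := by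
    intro z hz hzt
    obtain ⟨i, hi, hzi⟩ := mem_polyTrace_iff.1 hzt
    rcases hw.eq_lv_rv_of_inter hδ hab hi hz hzi with ⟨h1, h2⟩ | ⟨h1, h2⟩
    · exact (h i hi).2 ⟨h1, h2⟩
    · exact (h i hi).1 ⟨h1, h2⟩
  exact (convex_segment _ _).isPreconnected.subset_connectedComponentIn (left_mem_segment _ _ _) hseg
    (right_mem_segment _ _ _)

/-- Two equal or adjacent **open** sites have the same winding number (an open–open edge is not
crossed: the right site of every dart is closed). [folklore] -/
theorem IsSiteInterfaceLoop.loopWind_triMeshPoint_eq_of_mem {a b : Site 2} (hab : a = b ∨ triGraph.Adj a b)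
    (ha : a ∈ ω) (hb : b ∈ ω) : loopWind δ w (triMeshPoint δ a) = loopWind δ w (triMeshPoint δ b) :=
  hw.loopWind_triMeshPoint_eq_of_adj hδ hab fun _ hi ↦
    ⟨fun hh ↦ hw.rv_not_mem hi (hh.2 ▸ hb), fun hh ↦ hw.rv_not_mem hi (hh.1 ▸ ha)⟩

/-- Two equal or adjacent **closed** sites have the same winding number (a closed–closed edge is
not crossed: the left site of every dart is open). [folklore] -/
theorem IsSiteInterfaceLoop.loopWind_triMeshPoint_eq_of_not_mem {a b : Site 2} (hab : a = b ∨ triGraph.Adj a b)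
    (ha : a ∉ ω) (hb : b ∉ ω) : loopWind δ w (triMeshPoint δ a) = loopWind δ w (triMeshPoint δ b) :=
  hw.loopWind_triMeshPoint_eq_of_adj hδ hab fun _ hi ↦
    ⟨fun hh ↦ ha (hh.1 ▸ hw.lv_mem hi), fun hh ↦ hb (hh.2 ▸ hw.lv_mem hi)⟩

end Jump

/-! ### Transport along chains of sites; the macroscopic-loop lemma -/

section Chains

variable {ω : SiteConfig (Site 2)} {f₀ : HexVertex} {w : hexGraph.Walk f₀ f₀}
  (hw : IsSiteInterfaceLoop ω w) {δ : ℝ} (hδ : 0 < δ)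

include hw

/-- The right site is a vertex of the next face as well. [folklore] -/
theorem IsSiteInterfaceLoop.rv_mem_hexFaceVertices_succ {i : ℕ} (hi : i < w.length) :
    hw.rv i ∈ hexFaceVertices (w.getVert (i + 1)) := by
  rw [hw.getVert_succ_eq hi, hw.rv_eq hi, ← faceVertex_oppFace_succ_succ]
  exact faceVertex_mem _ _

/-- The right site is a vertex of the current face. [folklore] -/
theorem IsSiteInterfaceLoop.rv_mem_hexFaceVertices {i : ℕ} (hi : i < w.length) :
    hw.rv i ∈ hexFaceVertices (w.getVert i) := by
  rw [hw.rv_eq hi]; exact faceVertex_mem _ _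

/-- **Consecutive right sites are equal or adjacent** (both are vertices of the face in
between): the closed hexagons on the right of an interface form a connected chain
(Camia–Newman 2006, §4). [cite: CamiaNewman2006, §4] -/
theorem IsSiteInterfaceLoop.rv_succ_eq_or_adj {i : ℕ} (hi : i + 1 < w.length) :
    hw.rv (i + 1) = hw.rv i ∨ triGraph.Adj (hw.rv i) (hw.rv (i + 1)) := by
  by_cases h : hw.rv (i + 1) = hw.rv i
  · exact Or.inl h
  · exact Or.inr (adj_of_mem_hexFaceVertices (hw.rv_mem_hexFaceVertices_succ (by omega))
      (hw.rv_mem_hexFaceVertices hi) (Ne.symm h))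

include hδ

/-- **Transport of the winding number along a chain of sites.** If `g 0, …, g m` are sites,
consecutive ones equal or adjacent, and no consecutive pair is a crossed edge of the loop (in
either orientation), then the closed polygon winds equally about the first and the last site.
[folklore] -/
theorem IsSiteInterfaceLoop.loopWind_triMeshPoint_eq_of_chain (g : ℕ → Site 2) :
    ∀ m : ℕ, (∀ k < m, g k = g (k + 1) ∨ triGraph.Adj (g k) (g (k + 1))) →
      (∀ k < m, ∀ i < w.length, ¬ (g k = hw.lv i ∧ g (k + 1) = hw.rv i) ∧
        ¬ (g k = hw.rv i ∧ g (k + 1) = hw.lv i)) →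
      loopWind δ w (triMeshPoint δ (g 0)) = loopWind δ w (triMeshPoint δ (g m))
  | 0, _, _ => rfl
  | m + 1, hstep, hcond => by
    rw [IsSiteInterfaceLoop.loopWind_triMeshPoint_eq_of_chain g m (fun k hk ↦ hstep k (by omega))
      (fun k hk ↦ hcond k (by omega))]
    exact hw.loopWind_triMeshPoint_eq_of_adj hδ (hstep m (by omega)) (hcond m (by omega))

/-- **The macroscopic-loop lemma.** Let the `i`-th dart of an interface loop `w` at mesh
`δ > 0` have its left (open) site joined to a site at distance `> ρ` from `x` by a chain of
sites none of whose consecutive pairs is a crossed edge of `w`, and likewise its right (closed)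
site. Then the trace of `w` is **not** contained in the disc `B̄(x, ρ)`: otherwise the winding
numbers about both far endpoints vanish (`loopWind_eq_zero_of_lt_dist`), transport along the
chains gives `wind (leftPt i) = wind (rightPt i) = 0`, contradicting the jump
`wind (leftPt i) - wind (rightPt i) = 1`. (This is how an open circuit and a disjoint closed
circuit force a large interface loop between them; Camia–Newman 2006, proof of Thm 2 (ii).)
[cite: CamiaNewman2006, Thm 2] -/
theorem IsSiteInterfaceLoop.not_polyTrace_subset_closedBall {i : ℕ} (hi : i < w.length) {x : ℂ} {ρ : ℝ}
    (gL : ℕ → Site 2) (mL : ℕ) (hL0 : gL 0 = hw.lv i)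
    (hLstep : ∀ k < mL, gL k = gL (k + 1) ∨ triGraph.Adj (gL k) (gL (k + 1)))
    (hLcond : ∀ k < mL, ∀ j < w.length, ¬ (gL k = hw.lv j ∧ gL (k + 1) = hw.rv j) ∧
      ¬ (gL k = hw.rv j ∧ gL (k + 1) = hw.lv j))
    (hLfar : ρ < dist (triMeshPoint δ (gL mL)) x)
    (gR : ℕ → Site 2) (mR : ℕ) (hR0 : gR 0 = hw.rv i)
    (hRstep : ∀ k < mR, gR k = gR (k + 1) ∨ triGraph.Adj (gR k) (gR (k + 1)))
    (hRcond : ∀ k < mR, ∀ j < w.length, ¬ (gR k = hw.lv j ∧ gR (k + 1) = hw.rv j) ∧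
      ¬ (gR k = hw.rv j ∧ gR (k + 1) = hw.lv j))
    (hRfar : ρ < dist (triMeshPoint δ (gR mR)) x) :
    ¬ polyTrace δ w ⊆ closedBall x ρ := by
  intro hsub
  have hlen : 0 < w.length := by omega
  have hL := hw.loopWind_triMeshPoint_eq_of_chain hδ gL mL hLstep hLcond
  have hR := hw.loopWind_triMeshPoint_eq_of_chain hδ gR mR hRstep hRcond
  rw [loopWind_eq_zero_of_lt_dist hlen hsub hLfar, hL0] at hL
  rw [loopWind_eq_zero_of_lt_dist hlen hsub hRfar, hR0] at hR
  rcases hw.loopWind_leftPt_ne_zero_or hδ hi with h | h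
  · exact h hL
  · exact h hR

end Chains

end Literature.Probability.Percolation
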